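import Summits.PneNP.PneNP.Theorems.ChebyshevTracialDesignSynchronisationTools
import Summits.PneNP.PneNP.Theorems.ChebyshevTracialDesignPsdCells
import HarnessLib

/-!
# Cell pnp-psdrank, route `ChebyshevTracialDesign`: the GIANT CLASS / GIANT COMPONENT of a dense × homogeneous-dense tight pair
# (crux `TracialDecayExp20`, stmt-PneNP-19878)

Brick 72 (prover g13; MEMO-16 §2). Brick 61 (`…DimTwoSynchronisation`) proved the `r = 2` dense cell by ANGLE SYNCHRONISATION: tight active pairs have
equal labels, quantitative non-tightness ((SNT-q), brick 65, mod KL) makes every `ε`-heavy set of cut labels carry more than half of the matching mass,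
and the majority lemma (brick 59) leaves ONE label with all but `2ε` of the cut mass. Nothing in that argument is two-dimensional except the source of the
labels. This file abstracts it, at EVERY dimension `r`:

* §1 **`giant_class`** — for a `[0,1]`-weight `x` on the `t`-cuts, a nonnegative matching weight `z`, and ANY labelling `κ` of cuts / `λ` of matchings by a
  common label type that is TIGHT-CLOSED (an active tight pair — `cc(U,M) = 1`, `x_U > 0`, `z_M > 0` — has `κ U = λ M`), the (SNT-q)-existence hypothesis of
  bricks 59/61 (every `[0,1]` cut weight of mass `≥ ε·#t-cuts` and every sub-weight of `z` carrying at least half of it have an active tight pair) forces ONE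
  label `i` with `Σ_{κ U ≠ i} x_U ≤ 2ε·#t-cuts`.
* §2 **`giant_component`** — the canonical tight-closed labelling is by CONNECTED COMPONENTS of the active tight graph: for every simple graph `G` on
  `t-cuts ⊔ matchings` in which active tight pairs are adjacent, one connected component carries all but `2ε·#t-cuts` of `x`. (Any coarser tight-closed
  partition — atoms of a rank-one strategy at `r = 2`, blocks of a block-diagonal strategy, the classes of a subspace cover — is an instance of §1.)
* §3 **`value_le_giant_class_add`** — for a tight-orthogonal psd rectangle `(X, Y)` of dimension `r` on the `t`-cuts with cut trace mass `≥ 2ε·r·#t-cuts`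
  and a tight-closed labelling of its ACTIVE operators (`X_U ≠ 0`, `Y_M ≠ 0` tight ⇒ equal labels), under (SNT-q) for `tr Y/r`: the design value splits as
  (value of the giant cut class) + junk `≤ 2·B_v·ε·r` (trace marginal, brick 51). NORMAL FORM: in the dense non-crossing psd cell one may assume the active
  tight graph CONNECTED through the cut side, at cost `2B_v ε r`.
[cite: Rothvoss2017, §2 (PDF p. 6)] [cite: KupavskiiZakharov2022, §2] [cite: BrietDadushPokutta2014, Thm. 6 (§3)]
Stature: support/instrument (combinatorics; the (SNT-q) input is a hypothesis, discharged mod KL by brick 65 `weightedSNT_subweights_of_globalLevelD`).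
WHAT THIS IS NOT: no bound on the giant class itself (for `r ≥ 3` labels are not constant on components), nothing on psd rank of P_PM(K_n), no P-vs-NP content.
-/

set_option linter.dupNamespace false -- `Summit.PneNP.PneNP.…`: summit = sub-problem (D-0017)

noncomputable section

namespace Summit.PneNP.PneNP.Theorems.ChebyshevTracialDesignGiantComponent

open Finset Matrix Literature.Barriers.PneNP Literature.Combinatorics.Optimization
open Summit.PneNP.PneNP.Theorems.ChebyshevTracialDesignSynchronisationTools
open Summit.PneNP.PneNP.Theorems.ChebyshevTracialDesignPsdCells

variable {n : ℕ}

/-! ### §1 The giant class of a tight-closed labelling -/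

/-- **GIANT CLASS.** Let `x : t-cuts → [0,1]` (zero off the `t`-cuts), `z ≥ 0` a matching weight, and `κ`, `λ` labellings of cuts and matchings by a
common type that are TIGHT-CLOSED: every active tight pair (`cc(U,M) = 1`, `x_U > 0`, `z_M > 0`) has `κ U = λ M`. Assume (SNT-q)-existence: every
`[0,1]` cut weight `x'` on the `t`-cuts of mass `≥ ε·#t-cuts` and every sub-weight `z' ≤ z` with `Σ z ≤ 2 Σ z'` have an active tight pair. If
`Σ x ≥ 2ε·#t-cuts` then some label `i` carries all but `2ε·#t-cuts` of `x`. (Majority lemma, brick 59: the `κ`-classes of an `ε`-heavy label set `G`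
and the `λ`-classes outside `G` have no active tight pair, so the latter carry less than half of `z`.) [cite: Rothvoss2017, §2 (PDF p. 6)]
[cite: KupavskiiZakharov2022, §2] -/
theorem giant_class {ι : Type*} [DecidableEq ι] {t : ℕ} (hne : (univ.filter fun U : OddSet n => U.1.card = t).Nonempty) {ε : ℝ}
    (hε : 0 < ε) {x : OddSet n → ℝ} {z : PMatch n → ℝ}
    (hx01 : ∀ U, 0 ≤ x U ∧ x U ≤ 1) (hxt : ∀ U, U.1.card ≠ t → x U = 0) (hz : ∀ M, 0 ≤ z M)
    (κ : OddSet n → ι) (lam : PMatch n → ι) (hclosed : ∀ U M, cc U M = 1 → 0 < x U → 0 < z M → κ U = lam M)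
    (hSNT : ∀ (x' : OddSet n → ℝ) (z' : PMatch n → ℝ), (∀ U, 0 ≤ x' U ∧ x' U ≤ 1) → (∀ U, U.1.card ≠ t → x' U = 0) →
      ε * ((univ.filter fun U : OddSet n => U.1.card = t).card : ℝ) ≤ ∑ U, x' U →
      (∀ M, 0 ≤ z' M ∧ z' M ≤ z M) → (∑ M, z M) ≤ 2 * ∑ M, z' M → ∃ U M, cc U M = 1 ∧ 0 < x' U ∧ 0 < z' M)
    (hdens : 2 * (ε * ((univ.filter fun U : OddSet n => U.1.card = t).card : ℝ)) ≤ ∑ U, x U) :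
    ∃ i, ∑ U ∈ univ.filter (fun U => κ U ≠ i), x U ≤ 2 * (ε * ((univ.filter fun U : OddSet n => U.1.card = t).card : ℝ)) := by
  classical
  set Nt : ℝ := ((univ.filter fun U : OddSet n => U.1.card = t).card : ℝ) with hNt
  have hNpos : 0 < ε * Nt := mul_pos hε (by rw [hNt]; exact_mod_cast card_pos.2 hne)
  -- labels and the two masses per label
  set L : Finset ι := univ.image κ ∪ univ.image lam with hL
  set a : ι → ℝ := fun i => ∑ U ∈ univ.filter (fun U => κ U = i), x U with ha
  set b : ι → ℝ := fun i => ∑ M ∈ univ.filter (fun M => lam M = i), z M with hb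
  have haG : ∀ G : Finset ι, ∑ i ∈ G, a i = ∑ U ∈ univ.filter (fun U => κ U ∈ G), x U := by
    intro G
    rw [ha, ← sum_fiberwise_of_maps_to (s := univ.filter (fun U => κ U ∈ G)) (t := G) (g := κ) (f := x)
      (fun U hU => (mem_filter.1 hU).2)]
    refine sum_congr rfl fun i hi => sum_congr ?_ fun _ _ => rfl
    ext U
    simp only [mem_filter, mem_univ, true_and]
    exact ⟨fun h => ⟨h ▸ hi, h⟩, fun h => h.2⟩
  have hbG : ∀ G : Finset ι, ∑ i ∈ G, b i = ∑ M ∈ univ.filter (fun M => lam M ∈ G), z M := by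
    intro G
    rw [hb, ← sum_fiberwise_of_maps_to (s := univ.filter (fun M => lam M ∈ G)) (t := G) (g := lam) (f := z)
      (fun M hM => (mem_filter.1 hM).2)]
    refine sum_congr rfl fun i hi => sum_congr ?_ fun _ _ => rfl
    ext M
    simp only [mem_filter, mem_univ, true_and]
    exact ⟨fun h => ⟨h ▸ hi, h⟩, fun h => h.2⟩
  have hκL : ∀ U, κ U ∈ L := fun U => mem_union_left _ (mem_image_of_mem _ (mem_univ U))
  have hlamL : ∀ M, lam M ∈ L := fun M => mem_union_right _ (mem_image_of_mem _ (mem_univ M))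
  have haL : ∑ i ∈ L, a i = ∑ U, x U := by
    rw [haG L, filter_true_of_mem fun U _ => hκL U]
  have hbL : ∑ i ∈ L, b i = ∑ M, z M := by
    rw [hbG L, filter_true_of_mem fun M _ => hlamL M]
  -- MAJORITY PREMISE from (SNT-q) + tight-closedness
  have hmaj : ∀ G, G ⊆ L → ε * Nt ≤ ∑ i ∈ G, a i → ∑ i ∈ L, b i < 2 * ∑ i ∈ G, b i := by
    intro G _ hGa
    by_contra hle
    push Not at hle
    set x' : OddSet n → ℝ := fun U => if κ U ∈ G then x U else 0 with hx'
    set z' : PMatch n → ℝ := fun M => if lam M ∉ G then z M else 0 with hz'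
    have hx'01 : ∀ U, 0 ≤ x' U ∧ x' U ≤ 1 := fun U => by
      rw [hx']; dsimp only; split_ifs
      · exact hx01 U
      · exact ⟨le_rfl, zero_le_one⟩
    have hx't : ∀ U, U.1.card ≠ t → x' U = 0 := fun U hU => by
      rw [hx']; dsimp only; split_ifs
      · exact hxt U hU
      · rfl
    have hx'sum : ∑ U, x' U = ∑ i ∈ G, a i := by rw [haG G, hx', ← sum_filter]
    have hz'01 : ∀ M, 0 ≤ z' M ∧ z' M ≤ z M := fun M => by
      rw [hz']; dsimp only; split_ifs
      · exact ⟨le_rfl, hz M⟩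
      · exact ⟨hz M, le_rfl⟩
    have hz'sum : ∑ M, z' M = ∑ i ∈ L, b i - ∑ i ∈ G, b i := by
      have h1 : ∑ M, z' M = ∑ M ∈ univ.filter (fun M => lam M ∉ G), z M := by
        rw [hz', ← sum_filter]
      have h2 := sum_filter_add_sum_filter_not (univ : Finset (PMatch n)) (fun M => lam M ∈ G) z
      rw [h1, hbL, ← h2, hbG G]; ring
    have hhalf : (∑ M, z M) ≤ 2 * ∑ M, z' M := by rw [hz'sum, hbL]; linarith
    obtain ⟨U, M, hcc, hxU, hzM⟩ := hSNT x' z' hx'01 hx't (by rw [hx'sum]; exact hGa) hz'01 hhalf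
    have hUG : κ U ∈ G := by by_contra h; rw [hx'] at hxU; dsimp only at hxU; rw [if_neg h] at hxU; exact lt_irrefl _ hxU
    have hMG : lam M ∉ G := by
      by_contra h; rw [hz'] at hzM; dsimp only at hzM; rw [if_neg (fun hn => hn h)] at hzM; exact lt_irrefl _ hzM
    have hxU' : 0 < x U := by rw [hx'] at hxU; dsimp only at hxU; rwa [if_pos hUG] at hxU
    have hzM' : 0 < z M := by rw [hz'] at hzM; dsimp only at hzM; rwa [if_pos hMG] at hzM
    exact hMG (hclosed U M hcc hxU' hzM' ▸ hUG)
  obtain ⟨i, -, hi⟩ := exists_heavy_label L a b hNpos hmaj (by rw [haL]; exact hdens)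
  refine ⟨i, ?_⟩
  have hsplit := sum_filter_add_sum_filter_not (univ : Finset (OddSet n)) (fun U => κ U = i) x
  have hai : a i = ∑ U ∈ univ.filter (fun U => κ U = i), x U := rfl
  rw [haL] at hi
  linarith

/-! ### §2 The giant component of the active tight graph -/

open scoped Classical in
/-- **GIANT COMPONENT.** In the setting of `giant_class`, let `G` be any simple graph on `t-cuts ⊔ matchings` in which every active tight pair is an edge
(`cc(U,M) = 1`, `x_U > 0`, `z_M > 0 ⇒ G.Adj (inl U) (inr M)`; e.g. the active tight graph itself). Then ONE connected component of `G` carries all but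
`2ε·#t-cuts` of `x`: labelling by connected components is tight-closed. [cite: Rothvoss2017, §2 (PDF p. 6)] [cite: KupavskiiZakharov2022, §2] -/
theorem giant_component {t : ℕ} (hne : (univ.filter fun U : OddSet n => U.1.card = t).Nonempty) {ε : ℝ} (hε : 0 < ε)
    {x : OddSet n → ℝ} {z : PMatch n → ℝ}
    (hx01 : ∀ U, 0 ≤ x U ∧ x U ≤ 1) (hxt : ∀ U, U.1.card ≠ t → x U = 0) (hz : ∀ M, 0 ≤ z M)
    (G : SimpleGraph (OddSet n ⊕ PMatch n)) (hG : ∀ U M, cc U M = 1 → 0 < x U → 0 < z M → G.Adj (Sum.inl U) (Sum.inr M))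
    (hSNT : ∀ (x' : OddSet n → ℝ) (z' : PMatch n → ℝ), (∀ U, 0 ≤ x' U ∧ x' U ≤ 1) → (∀ U, U.1.card ≠ t → x' U = 0) →
      ε * ((univ.filter fun U : OddSet n => U.1.card = t).card : ℝ) ≤ ∑ U, x' U →
      (∀ M, 0 ≤ z' M ∧ z' M ≤ z M) → (∑ M, z M) ≤ 2 * ∑ M, z' M → ∃ U M, cc U M = 1 ∧ 0 < x' U ∧ 0 < z' M)
    (hdens : 2 * (ε * ((univ.filter fun U : OddSet n => U.1.card = t).card : ℝ)) ≤ ∑ U, x U) :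
    ∃ c : G.ConnectedComponent, ∑ U ∈ univ.filter (fun U => G.connectedComponentMk (Sum.inl U) ≠ c), x U ≤
      2 * (ε * ((univ.filter fun U : OddSet n => U.1.card = t).card : ℝ)) :=
  giant_class hne hε hx01 hxt hz (fun U => G.connectedComponentMk (Sum.inl U)) (fun M => G.connectedComponentMk (Sum.inr M))
    (fun U M hcc hxU hzM => SimpleGraph.ConnectedComponent.sound (hG U M hcc hxU hzM).reachable) hSNT hdens

/-! ### §3 Tight psd rectangles: the value is carried by the giant class -/

/-- **THE VALUE IS CARRIED BY THE GIANT CLASS (normal form for the dense psd cell).** Let `(X, Y)` be a tight-orthogonal psd rectangle of dimension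
`r ≥ 1` supported on the `t`-cuts, `W = levelWeight n t C w` with `Σ|w_c| ≤ B_v`, and `κ`, `λ` a tight-closed labelling of the ACTIVE operators
(`cc(U,M) = 1`, `X_U ≠ 0`, `Y_M ≠ 0 ⇒ κ U = λ M` — e.g. connected components of the active tight graph, or any coarsening). Assume (SNT-q)-existence
for the trace weight `tr Y/r` (hypothesis `hSNT`, the shape of bricks 59/61; a theorem mod KL for homogeneous-dense `tr Y/r` by brick 65) and cut trace
mass `Σ tr X_U / r ≥ 2ε·#t-cuts`. Then for some label `i`: the cut classes `≠ i` carry trace mass `≤ 2ε r·#t-cuts`, and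
`Σ_U Σ_M W tr(X_U Y_M) ≤ Σ_{κ U = i} Σ_M W tr(X_U Y_M) + 2·B_v·ε·r` (trace marginal, brick 51).
[cite: Rothvoss2017, §2 (PDF p. 6)] [cite: BrietDadushPokutta2014, Thm. 6 (§3)] [cite: KupavskiiZakharov2022, §2] -/
theorem value_le_giant_class_add {ι : Type*} [DecidableEq ι] {t r : ℕ} (hr : 0 < r)
    (hne : (univ.filter fun U : OddSet n => U.1.card = t).Nonempty) (C : Finset ℕ) (w : ℕ → ℝ) {Bv ε : ℝ}
    (hBv : ∑ c ∈ C, |w c| ≤ Bv) (hε : 0 < ε)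
    {X : OddSet n → Matrix (Fin r) (Fin r) ℝ} {Y : PMatch n → Matrix (Fin r) (Fin r) ℝ} (hXY : IsPsdRect X Y)
    (hXt : ∀ U, U.1.card ≠ t → X U = 0) (κ : OddSet n → ι) (lam : PMatch n → ι)
    (hclosed : ∀ U M, cc U M = 1 → X U ≠ 0 → Y M ≠ 0 → κ U = lam M)
    (hSNT : ∀ (x' : OddSet n → ℝ) (z' : PMatch n → ℝ), (∀ U, 0 ≤ x' U ∧ x' U ≤ 1) → (∀ U, U.1.card ≠ t → x' U = 0) →
      ε * ((univ.filter fun U : OddSet n => U.1.card = t).card : ℝ) ≤ ∑ U, x' U →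
      (∀ M, 0 ≤ z' M ∧ z' M ≤ (Y M).trace / r) → (∑ M, (Y M).trace / r) ≤ 2 * ∑ M, z' M →
      ∃ U M, cc U M = 1 ∧ 0 < x' U ∧ 0 < z' M)
    (hdens : 2 * (ε * ((univ.filter fun U : OddSet n => U.1.card = t).card : ℝ)) ≤ ∑ U, (X U).trace / r) :
    ∃ i, ∑ U ∈ univ.filter (fun U => κ U ≠ i), (X U).trace ≤ 2 * ε * r * ((univ.filter fun U : OddSet n => U.1.card = t).card : ℝ) ∧
      ∑ U, ∑ M, levelWeight n t C w U M * (X U * Y M).trace ≤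
        ∑ U ∈ univ.filter (fun U => κ U = i), ∑ M, levelWeight n t C w U M * (X U * Y M).trace + 2 * Bv * ε * r := by
  classical
  set Nt : ℝ := ((univ.filter fun U : OddSet n => U.1.card = t).card : ℝ) with hNt
  have hr' : (0 : ℝ) < r := by exact_mod_cast hr
  have hBv0 : 0 ≤ Bv := (sum_nonneg fun c _ => abs_nonneg (w c)).trans hBv
  -- trace weights
  have hx01 : ∀ U, 0 ≤ (X U).trace / r ∧ (X U).trace / r ≤ 1 := fun U => by
    refine ⟨div_nonneg (hXY.1 U).1.trace_nonneg hr'.le, ?_⟩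
    rw [div_le_one hr']
    have h := (hXY.1 U).2.trace_nonneg
    rw [trace_sub, trace_one, Fintype.card_fin] at h
    linarith
  have hxt : ∀ U, U.1.card ≠ t → (X U).trace / r = 0 := fun U hU => by rw [hXt U hU, trace_zero, zero_div]
  have hz : ∀ M, 0 ≤ (Y M).trace / r := fun M => div_nonneg (hXY.2.1 M).1.trace_nonneg hr'.le
  have hclosed' : ∀ U M, cc U M = 1 → 0 < (X U).trace / r → 0 < (Y M).trace / r → κ U = lam M := by
    intro U M hcc hxU hzM
    refine hclosed U M hcc (fun h => ?_) (fun h => ?_)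
    · rw [h, trace_zero, zero_div] at hxU; exact lt_irrefl _ hxU
    · rw [h, trace_zero, zero_div] at hzM; exact lt_irrefl _ hzM
  obtain ⟨i, hi⟩ := giant_class hne hε hx01 hxt hz κ lam hclosed' hSNT hdens
  refine ⟨i, ?_, ?_⟩
  · have h : ∑ U ∈ univ.filter (fun U => κ U ≠ i), (X U).trace = r * ∑ U ∈ univ.filter (fun U => κ U ≠ i), (X U).trace / r := by
      rw [mul_sum]; exact sum_congr rfl fun U _ => by field_simp
    rw [h]
    calc (r : ℝ) * ∑ U ∈ univ.filter (fun U => κ U ≠ i), (X U).trace / r ≤ r * (2 * (ε * Nt)) :=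
          mul_le_mul_of_nonneg_left hi hr'.le
      _ = 2 * ε * r * Nt := by ring
  · -- split the cut side into the class of `i` and the rest; the rest is junk by the trace marginal
    have hsplit : ∑ U, ∑ M, levelWeight n t C w U M * (X U * Y M).trace =
        ∑ U ∈ univ.filter (fun U => κ U = i), ∑ M, levelWeight n t C w U M * (X U * Y M).trace +
          ∑ U ∈ univ.filter (fun U => ¬κ U = i), ∑ M, levelWeight n t C w U M * (X U * Y M).trace :=
      (sum_filter_add_sum_filter_not univ (fun U => κ U = i) _).symm
    rw [hsplit]
    suffices hjunk : ∑ U ∈ univ.filter (fun U => ¬κ U = i), ∑ M, levelWeight n t C w U M * (X U * Y M).trace ≤ 2 * Bv * ε * r by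
      linarith
    have h1 := abs_cell_value_le_row (t := t) hr C w hXY (univ.filter fun U => ¬κ U = i) univ
    have h2 : ∑ U ∈ univ.filter (fun U => ¬κ U = i), ∑ M, levelWeight n t C w U M * (X U * Y M).trace =
        ∑ U ∈ univ.filter (fun U => ¬κ U = i), ∑ M ∈ univ, levelWeight n t C w U M * (X U * Y M).trace := rfl
    rw [h2]
    refine (le_abs_self _).trans (h1.trans ?_)
    -- the relevant cut trace mass is at most that of all classes `≠ i`
    have hmass : ∑ U ∈ (univ.filter fun U : OddSet n => ¬κ U = i).filter (fun U => U.1.card = t), (X U).trace ≤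
        ∑ U ∈ univ.filter (fun U => κ U ≠ i), (X U).trace :=
      sum_le_sum_of_subset_of_nonneg (fun U hU => mem_filter.2 ⟨mem_univ _, (mem_filter.1 (mem_filter.1 hU).1).2⟩)
        fun U _ _ => (hXY.1 U).1.trace_nonneg
    have hmass' : ∑ U ∈ univ.filter (fun U => κ U ≠ i), (X U).trace ≤ r * (2 * (ε * Nt)) := by
      have h : ∑ U ∈ univ.filter (fun U => κ U ≠ i), (X U).trace = r * ∑ U ∈ univ.filter (fun U => κ U ≠ i), (X U).trace / r := by
        rw [mul_sum]; exact sum_congr rfl fun U _ => by field_simp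
      rw [h]; exact mul_le_mul_of_nonneg_left hi hr'.le
    have hNpos : 0 < Nt := by rw [hNt]; exact_mod_cast card_pos.2 hne
    have hw0 : 0 ≤ ∑ c ∈ C, |w c| := sum_nonneg fun c _ => abs_nonneg (w c)
    calc (∑ c ∈ C, |w c|) *
          ((∑ U ∈ (univ.filter fun U : OddSet n => ¬κ U = i).filter (fun U => U.1.card = t), (X U).trace) / Nt)
        ≤ Bv * ((r * (2 * (ε * Nt))) / Nt) := by
          refine mul_le_mul hBv (div_le_div_of_nonneg_right (hmass.trans hmass') hNpos.le) ?_ hBv0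
          exact div_nonneg (sum_nonneg fun U _ => (hXY.1 U).1.trace_nonneg) hNpos.le
      _ = 2 * Bv * ε * r := by field_simp

end Summit.PneNP.PneNP.Theorems.ChebyshevTracialDesignGiantComponent
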